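import Mathlib
import HarnessLib
import Summits.ResolutionOfSingularities.ResolutionOfSingularities.Theorems.WildQuotientsWildQuotientResolutionS1aValuativeAdmissibleCriteria

/-!
# S1a — THE CENSUS FRAME ON `𝔸⁴`: σ-admissibility of the monomial valuation = plan-1's weight inequalities (TWISTED §2), with the A₂-cusp row as an instance

[OURS · L1 W4.5c · lead-1 g9; plan-1 g12 TWISTED-INVARIANT-DESIGN v1 §2 "the rule reproduces recipe table v3 (hand arithmetic; frame
σ = (x1, x2 + x1, x3 + x1, x4 + θ(x1,x2,x3)))" made formal at the ring level] — NOT statements of the manuscript; counted 0; AI-level work, weaker than expert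
review. Crux stmt-ResolutionOfSingularities-17941, line `s1a-logminvertex` v10 (serves `KillAdmValReach` / `AuxAdmValAt` via `polyVal_admissible` and
`CentredVal.isSigmaAdmissible_ofSections`). Route-independent; pure algebra on `k[x₀, x₁, x₂, x₃]` (0-indexed: the census' `x1..x4` are `X 0..X 3`).

* `censusFrame θ : k[x] →ₐ[k] k[x]`, `x₀ ↦ x₀, x₁ ↦ x₁ + x₀, x₂ ↦ x₂ + x₀, x₃ ↦ x₃ + θ` (`censusFrame_X₀…₃`); `polyVal_X`.
* ★★ `polyVal_admissible_censusFrame`: if `w 1 + δ ≤ w 0`, `w 2 + δ ≤ w 0` and `w 3 + δ ≤ polyVal w θ` then the monomial valuation `polyVal w` is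
  σ-admissible with `δ` for `σ = censusFrame θ` on ALL of `k[x]` — exactly TWISTED §2's constraints "w1 ≥ w2 + δ, w1 ≥ w3 + δ, v_w(θ) ≥ w4 + δ".
* ★ `polyVal_admissible_cusp`: the A₂-CUSP ROW of the recipe table — `θ = x₁² − x₂³`, weights `(9; 3, 2; 0)`, `δ = 6` ("w1 = deg θ + w2 = 6 + 3") — is
  admissible: `polyVal w φ + 6 ≤ polyVal w (σ φ − φ)` for every `φ`.
-/

set_option linter.dupNamespace false

noncomputable section

open MvPolynomial

namespace Summit.ResolutionOfSingularities.ResolutionOfSingularities.Theorems.WildQuotientResolution.S1.Valuative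

variable {k : Type*} [Field k]

/-- The weighted order of a coordinate is its weight. -/
theorem polyVal_X {σ : Type*} (w : σ → ℕ) (i : σ) : polyVal w (X i : MvPolynomial σ k) = w i := by
  rw [show (X i : MvPolynomial σ k) = monomial (Finsupp.single i 1) 1 from (pow_one (X i)).symm.trans X_pow_eq_monomial,
    polyVal_monomial w _ one_ne_zero, Finsupp.weight_single, one_smul]

/-- **The census frame** `σ = (x₀, x₁ + x₀, x₂ + x₀, x₃ + θ)` as a `k`-algebra endomorphism of `k[x₀,…,x₃]`. [OURS · L1 W4.5c] -/
def censusFrame (θ : MvPolynomial (Fin 4) k) : MvPolynomial (Fin 4) k →ₐ[k] MvPolynomial (Fin 4) k :=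
  MvPolynomial.aeval ![X 0, X 1 + X 0, X 2 + X 0, X 3 + θ]

/-- `σ x₀ = x₀`. -/
@[simp] theorem censusFrame_X₀ (θ : MvPolynomial (Fin 4) k) : censusFrame θ (X 0) = X 0 := by
  simp [censusFrame]

/-- `σ x₁ = x₁ + x₀`. -/
@[simp] theorem censusFrame_X₁ (θ : MvPolynomial (Fin 4) k) : censusFrame θ (X 1) = X 1 + X 0 := by
  simp [censusFrame]

/-- `σ x₂ = x₂ + x₀`. -/
@[simp] theorem censusFrame_X₂ (θ : MvPolynomial (Fin 4) k) : censusFrame θ (X 2) = X 2 + X 0 := by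
  simp [censusFrame]

/-- `σ x₃ = x₃ + θ`. -/
@[simp] theorem censusFrame_X₃ (θ : MvPolynomial (Fin 4) k) : censusFrame θ (X 3) = X 3 + θ := by
  simp [censusFrame]

/-- ★★ **TWISTED §2 AS A THEOREM: the weight inequalities of the census frame ARE σ-admissibility of the monomial valuation.** If `w 1 + δ ≤ w 0`,
`w 2 + δ ≤ w 0` and `w 3 + δ ≤ v_w(θ)`, then `v_w(σ φ − φ) ≥ v_w(φ) + δ` for every polynomial `φ`, `σ = censusFrame θ`. [OURS · L1 W4.5c] -/
theorem polyVal_admissible_censusFrame (w : Fin 4 → ℕ) (δ : ℕ) (θ : MvPolynomial (Fin 4) k)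
    (h₁ : w 1 + δ ≤ w 0) (h₂ : w 2 + δ ≤ w 0) (hθ : (w 3 : ℕ∞) + δ ≤ polyVal w θ) (φ : MvPolynomial (Fin 4) k) :
    polyVal w φ + δ ≤ polyVal w (censusFrame θ φ - φ) := by
  refine polyVal_admissible w (censusFrame θ) δ (fun i => ?_) φ
  fin_cases i
  · simp
  · change (w 1 : ℕ∞) + δ ≤ polyVal w (censusFrame θ (X 1) - X 1)
    rw [censusFrame_X₁, add_sub_cancel_left, polyVal_X]
    exact_mod_cast h₁
  · change (w 2 : ℕ∞) + δ ≤ polyVal w (censusFrame θ (X 2) - X 2)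
    rw [censusFrame_X₂, add_sub_cancel_left, polyVal_X]
    exact_mod_cast h₂
  · change (w 3 : ℕ∞) + δ ≤ polyVal w (censusFrame θ (X 3) - X 3)
    rw [censusFrame_X₃, add_sub_cancel_left]
    exact hθ

/-- The A₂-cusp transversal type `θ = x₁² − x₂³`. -/
def cuspTheta : MvPolynomial (Fin 4) k := X 1 ^ 2 - X 2 ^ 3

/-- The census weights of the cusp row `(9; 3, 2; 0)` (root pattern "w1 = deg θ + w2"). -/
def cuspWeights : Fin 4 → ℕ := ![9, 3, 2, 0]

/-- `v_w(x₁² − x₂³) ≥ 6` for the cusp weights. -/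
theorem six_le_polyVal_cuspTheta : (6 : ℕ∞) ≤ polyVal cuspWeights (cuspTheta (k := k)) := by
  have h1 : polyVal cuspWeights (X 1 ^ 2 : MvPolynomial (Fin 4) k) = 6 := by
    rw [AddValuation.map_pow, polyVal_X]; rfl
  have h2 : polyVal cuspWeights (X 2 ^ 3 : MvPolynomial (Fin 4) k) = 6 := by
    rw [AddValuation.map_pow, polyVal_X]; rfl
  refine le_trans (le_min h1.ge h2.ge) ((polyVal cuspWeights).map_sub _ _)

/-- ★ **The A₂-cusp row of the recipe table is admissible**: weights `(9; 3, 2; 0)`, `δ = 6`, frame `σ = (x₀, x₁ + x₀, x₂ + x₀, x₃ + (x₁² − x₂³))`: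
`v_w(σ φ − φ) ≥ v_w(φ) + 6` for every `φ ∈ k[x₀,…,x₃]`. [OURS · L1 W4.5c] -/
theorem polyVal_admissible_cusp (φ : MvPolynomial (Fin 4) k) :
    polyVal cuspWeights φ + (6 : ℕ) ≤ polyVal cuspWeights (censusFrame cuspTheta φ - φ) :=
  polyVal_admissible_censusFrame cuspWeights 6 cuspTheta (by decide) (by decide)
    (by rw [show ((cuspWeights 3 : ℕ) : ℕ∞) + ((6 : ℕ) : ℕ∞) = 6 from rfl]; exact six_le_polyVal_cuspTheta) φ

end Summit.ResolutionOfSingularities.ResolutionOfSingularities.Theorems.WildQuotientResolution.S1.Valuative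

end
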